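import Literature.Barriers.NavierStokesRegularity.BuckmasterVicolNonuniqueness
import Literature.Barriers.AnomalousDissipation.ConvexIntegrationNonLerayProofs
import HarnessLib

/-!
# Buckmaster–Vicol 2019, Thm. 1.2 — proof architecture, I: the printed theorem as a named fact
  and the (proved) scaling step to the catalogued barrier

Sibling proof file of the barrier entry
`Literature/Barriers/NavierStokesRegularity/BuckmasterVicolNonuniqueness` (D-0021).

## References

* T. Buckmaster, V. Vicol, *Nonuniqueness of weak solutions to the Navier–Stokes equation*,
  Ann. of Math. 189 (2019), 101–144 = arXiv:1709.10033: §1 p. 2 (`ν ∈ (0,1]`, zero mean),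
  Def. 1.1, Thm. 1.2 (p. 3), §2.4 (proof of Thm. 1.2, pp. 5–6). [`BuckmasterVicol2019AnnMath`]
-/

noncomputable section

open MeasureTheory Set Filter
open scoped ENNReal InnerProductSpace ContDiff Topology

namespace Literature.Barriers.NavierStokesRegularity

open Literature.Analysis.FunctionSpaces

/-- The flat three-torus `T³ = (ℝ/ℤ)³` (local notation). -/
local notation "𝕋³" => UnitAddTorus (Fin 3)
/-- Velocity values (local notation). -/
local notation "ℝ³" => EuclideanSpace ℝ (Fin 3)

/-! ## Time rescaling `u(t, x) = μ v(μ t, x)` of weak solutions on the torus -/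

section Rescale

variable {μ : ℝ}

/-- Push-forward of Lebesgue measure on `(0, T)` under the dilation `t ↦ μ t`, `μ > 0`:
`(μ ·)_* (dt⌊(0,T)) = μ⁻¹ · dt⌊(0, μT)`. [folklore] -/
theorem map_mul_left_volume_restrict_Ioo (hμ : 0 < μ) (T : ℝ) :
    Measure.map (fun t : ℝ => μ * t) (volume.restrict (Ioo 0 T)) =
      ENNReal.ofReal μ⁻¹ • volume.restrict (Ioo 0 (μ * T)) := by
  have hmeas : Measurable (fun t : ℝ => μ * t) := measurable_const_mul μ
  have hpre : (fun t : ℝ => μ * t) ⁻¹' (Ioo 0 (μ * T)) = Ioo 0 T := by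
    ext t
    simp only [mem_preimage, mem_Ioo]
    constructor
    · rintro ⟨h1, h2⟩
      exact ⟨(mul_pos_iff_of_pos_left hμ).1 h1, lt_of_mul_lt_mul_left h2 hμ.le⟩
    · rintro ⟨h1, h2⟩
      exact ⟨mul_pos hμ h1, mul_lt_mul_of_pos_left h2 hμ⟩
  rw [← hpre, ← Measure.restrict_map hmeas measurableSet_Ioo, Real.map_volume_mul_left hμ.ne',
    Measure.restrict_smul, abs_of_pos (inv_pos.2 hμ)]

/-- Change of variables `s = μ t` in a time integral over `(0, T)`:
`∫_{(0,T)} H(μ t) dt = μ⁻¹ ∫_{(0,μT)} H(s) ds` (Bochner, any integrand). [folklore] -/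
theorem setIntegral_Ioo_comp_mul_left {G : Type*} [NormedAddCommGroup G] [NormedSpace ℝ G]
    (hμ : 0 < μ) (T : ℝ) (H : ℝ → G) :
    ∫ t in Ioo 0 T, H (μ * t) = μ⁻¹ • ∫ s in Ioo 0 (μ * T), H s := by
  have h := integral_map_equiv (μ := volume.restrict (Ioo 0 T)) (MeasurableEquiv.mulLeft₀ μ hμ.ne') H
  rw [MeasurableEquiv.coe_mulLeft₀, map_mul_left_volume_restrict_Ioo hμ T, integral_smul_measure,
    ENNReal.toReal_ofReal (inv_nonneg.2 hμ.le)] at h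
  exact h.symm

/-- Change of variables `s = μ t` in a lower Lebesgue time integral over `(0, T)`. [folklore] -/
theorem setLIntegral_Ioo_comp_mul_left (hμ : 0 < μ) (T : ℝ) (H : ℝ → ℝ≥0∞) :
    ∫⁻ t in Ioo 0 T, H (μ * t) = ENNReal.ofReal μ⁻¹ * ∫⁻ s in Ioo 0 (μ * T), H s := by
  have h := lintegral_map_equiv (μ := volume.restrict (Ioo 0 T)) H (MeasurableEquiv.mulLeft₀ μ hμ.ne')
  rw [MeasurableEquiv.coe_mulLeft₀, map_mul_left_volume_restrict_Ioo hμ T, lintegral_smul_measure] at h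
  exact h.symm

/-- Almost-everywhere statements on `(0, μT)` pull back to `(0, T)` along `t ↦ μ t`. [folklore] -/
theorem ae_restrict_Ioo_comp_mul_left (hμ : 0 < μ) {T : ℝ} {P : ℝ → Prop}
    (h : ∀ᵐ s ∂(volume.restrict (Ioo 0 (μ * T))), P s) :
    ∀ᵐ t ∂(volume.restrict (Ioo 0 T)), P (μ * t) := by
  have h' : ∀ᵐ s ∂(Measure.map (fun t : ℝ => μ * t) (volume.restrict (Ioo 0 T))), P s := by
    rw [map_mul_left_volume_restrict_Ioo hμ T]
    exact Measure.ae_smul_measure h _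
  exact ae_of_ae_map (measurable_const_mul μ).aemeasurable h'

/-- The space–time dilation `(t, y) ↦ (μ t, y)` is quasi-measure-preserving from
`dt dy⌊((0,T) × ℝ³)` to `dt dy⌊((0,μT) × ℝ³)`. [folklore] -/
theorem quasiMeasurePreserving_time_dilation (hμ : 0 < μ) (T : ℝ) :
    Measure.QuasiMeasurePreserving (fun p : ℝ × ℝ³ => (μ * p.1, p.2))
      (volume.restrict (Ioo 0 T ×ˢ univ)) (volume.restrict (Ioo 0 (μ * T) ×ˢ univ)) := by
  have h1 : Measure.QuasiMeasurePreserving (fun t : ℝ => μ * t) (volume.restrict (Ioo 0 T))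
      (volume.restrict (Ioo 0 (μ * T))) := by
    refine ⟨measurable_const_mul μ, ?_⟩
    rw [map_mul_left_volume_restrict_Ioo hμ T]
    exact Measure.smul_absolutelyContinuous
  have h2 : Measure.QuasiMeasurePreserving (id : ℝ³ → ℝ³) (volume : Measure ℝ³) volume :=
    Measure.QuasiMeasurePreserving.id volume
  have h := MeasureTheory.QuasiMeasurePreserving.prodMap h1 h2
  rw [Measure.volume_eq_prod, ← Measure.prod_restrict, ← Measure.prod_restrict, Measure.restrict_univ]
  exact h

variable {T ν₁ : ℝ} {v : ℝ → 𝕋³ → ℝ³}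

/-- Time dilation of a space–time test field supported in `(0, T)`: `s ↦ ψ(μ⁻¹ s)` is a test
field supported in `(0, μT)`. [folklore] -/
theorem isSpaceTimeTestIoo_comp_inv_mul (hμ : 0 < μ) {ψ : ℝ → 𝕋³ → ℝ³}
    (hψ : Torus.IsSpaceTimeTestIoo T ψ) :
    Torus.IsSpaceTimeTestIoo (μ * T) (fun s x => ψ (μ⁻¹ * s) x) := by
  obtain ⟨⟨hs, T', hT', h0⟩, ε, hε, hε0⟩ := hψ
  refine ⟨⟨?_, μ * T', mul_lt_mul_of_pos_left hT' hμ, fun s hs' => ?_⟩, μ * ε, mul_pos hμ hε,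
    fun s hs' => ?_⟩
  · have h : Torus.stLift (fun s x => ψ (μ⁻¹ * s) x) =
        Torus.stLift ψ ∘ fun p : ℝ × ℝ³ => (μ⁻¹ * p.1, p.2) := by
      funext p; rfl
    rw [h]
    exact hs.comp ((contDiff_const.mul contDiff_fst).prodMk contDiff_snd)
  · apply h0
    rw [le_inv_mul_iff₀ hμ]
    exact hs'
  · apply hε0
    rw [inv_mul_le_iff₀ hμ]
    exact hs'

/-- **Time rescaling of weak solutions.** If `v` is a weak solution of Navier–Stokes with
viscosity `ν₁` on `T³ × (0, μT)` (`Torus.IsWeakNSSolutionOn`), `μ > 0`, then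
`u(t, x) = μ v(μt, x)` is a weak solution with viscosity `μ ν₁` on `T³ × (0, T)`: the weak
identity for `u` against `ψ` is `μ²` times (after `s = μt`) the identity for `v` against
`s ↦ ψ(μ⁻¹ s)`; measurability, `L²_{t,x}` and weak incompressibility transport along the
dilation. (The invariance `v ↦ μ v(μ t, ·)`, `ν ↦ μν`, `p ↦ μ² p(μt, ·)` of the equations on a
fixed torus.) [folklore] -/
theorem isWeakNSSolutionOn_time_rescale (hμ : 0 < μ) (hv : Torus.IsWeakNSSolutionOn (μ * T) ν₁ v) :
    Torus.IsWeakNSSolutionOn T (μ * ν₁) (fun t x => μ • v (μ * t) x) := by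
  obtain ⟨h1, h2, h3, h4⟩ := hv
  refine ⟨?_, ?_, ?_, ?_⟩
  · -- measurability
    have h : Torus.stLift (fun t x => μ • v (μ * t) x) =
        fun p : ℝ × ℝ³ => μ • (Torus.stLift v ∘ fun p : ℝ × ℝ³ => (μ * p.1, p.2)) p := by
      funext p; rfl
    rw [h]
    exact (h1.comp_quasiMeasurePreserving (quasiMeasurePreserving_time_dilation hμ T)).const_smul μ
  · -- `L²_{t,x}`
    have h : ∀ t, ∫⁻ x, ‖μ • v (μ * t) x‖ₑ ^ 2 = ‖μ‖ₑ ^ 2 * ∫⁻ x, ‖v (μ * t) x‖ₑ ^ 2 := by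
      intro t
      simp only [enorm_smul, mul_pow]
      rw [lintegral_const_mul' _ _ (by simp)]
    have hcv := setLIntegral_Ioo_comp_mul_left hμ T (fun s => ‖μ‖ₑ ^ 2 * ∫⁻ x, ‖v s x‖ₑ ^ 2)
    dsimp only
    simp_rw [h]
    rw [hcv, lintegral_const_mul' _ _ (by simp)]
    exact ENNReal.mul_lt_top ENNReal.ofReal_lt_top (ENNReal.mul_lt_top (by simp) h2)
  · -- weak incompressibility for a.e. time
    have h := ae_restrict_Ioo_comp_mul_left hμ h3
    filter_upwards [h] with t ht
    intro θ hθ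
    have h0 := ht θ hθ
    simp_rw [real_inner_smul_left, integral_const_mul, h0, mul_zero]
  · -- the weak identity
    intro ψ hψ hdiv
    set φ : ℝ → 𝕋³ → ℝ³ := fun s x => ψ (μ⁻¹ * s) x with hφ_def
    have hφ : Torus.IsSpaceTimeTestIoo (μ * T) φ := isSpaceTimeTestIoo_comp_inv_mul hμ hψ
    have hφdiv : Torus.IsDivFreeTest φ := fun s => hdiv (μ⁻¹ * s)
    have key := h4 φ hφ hφdiv
    have hderiv : ∀ s x, Torus.timeDeriv φ s x = μ⁻¹ • Torus.timeDeriv ψ (μ⁻¹ * s) x := by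
      intro s x
      simp only [Torus.timeDeriv, hφ_def]
      exact deriv_comp_mul_left μ⁻¹ (fun τ => ψ τ x) s
    set H : ℝ → ℝ := fun s => ∫ x, (⟪v s x, Torus.timeDeriv φ s x⟫_ℝ +
      ⟪v s x, Torus.convect (v s) (φ s) x⟫_ℝ + ν₁ * ⟪v s x, Torus.laplacian (φ s) x⟫_ℝ) with hH_def
    have hcv : ∫ t in Ioo 0 T, H (μ * t) = μ⁻¹ • ∫ s in Ioo 0 (μ * T), H s :=
      setIntegral_Ioo_comp_mul_left hμ T H
    have hzero : ∫ t in Ioo 0 T, H (μ * t) = 0 := by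
      rw [hcv, key, smul_zero]
    have hφμ : ∀ t, φ (μ * t) = ψ t := fun t => by
      simp only [hφ_def, inv_mul_cancel_left₀ hμ.ne']
    have hpt : ∀ t, (∫ x, (⟪μ • v (μ * t) x, Torus.timeDeriv ψ t x⟫_ℝ +
        ⟪μ • v (μ * t) x, Torus.convect (fun x => μ • v (μ * t) x) (ψ t) x⟫_ℝ +
        μ * ν₁ * ⟪μ • v (μ * t) x, Torus.laplacian (ψ t) x⟫_ℝ)) = μ ^ 2 * H (μ * t) := by
      intro t
      have hμ0 : μ ≠ 0 := hμ.ne'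
      rw [hH_def]
      dsimp only
      rw [← integral_const_mul]
      refine integral_congr_ae (ae_of_all _ fun x => ?_)
      dsimp only
      have hc : Torus.convect (fun x => μ • v (μ * t) x) (ψ t) x =
          μ • Torus.convect (v (μ * t)) (ψ t) x := by
        simp only [Torus.convect, map_smul]
      rw [hc, hderiv, hφμ, inv_mul_cancel_left₀ hμ0]
      simp only [real_inner_smul_left, real_inner_smul_right]
      field_simp
    calc (∫ t in Ioo 0 T, ∫ x, (⟪μ • v (μ * t) x, Torus.timeDeriv ψ t x⟫_ℝ +
          ⟪μ • v (μ * t) x, Torus.convect (fun x => μ • v (μ * t) x) (ψ t) x⟫_ℝ +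
          μ * ν₁ * ⟪μ • v (μ * t) x, Torus.laplacian (ψ t) x⟫_ℝ))
        = ∫ t in Ioo 0 T, μ ^ 2 * H (μ * t) := setIntegral_congr_fun measurableSet_Ioo fun t _ => hpt t
      _ = 0 := by rw [integral_const_mul, hzero, mul_zero]

/-- Time rescaling of `C⁰_t H^β_x` regularity: if `s ↦ v(s)` is continuous on `[0, μT]` with
values in `H^β(T³)` then so is `t ↦ μ v(μt)` on `[0, T]` (`‖μ f‖_{H^β} = μ ‖f‖_{H^β}`). [folklore] -/
theorem continuousInSobolevOn_time_rescale (hμ : 0 < μ) {β : ℝ}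
    (hv : Torus.ContinuousInSobolevOn (Icc 0 (μ * T)) β (fun s => EuclideanSpace.complexify ∘ v s)) :
    Torus.ContinuousInSobolevOn (Icc 0 T) β
      (fun t => EuclideanSpace.complexify ∘ (fun x => μ • v (μ * t) x)) := by
  have hmaps : MapsTo (fun t : ℝ => μ * t) (Icc 0 T) (Icc 0 (μ * T)) := fun t ht =>
    ⟨mul_nonneg hμ.le ht.1, mul_le_mul_of_nonneg_left ht.2 hμ.le⟩
  have hfun : ∀ t, (EuclideanSpace.complexify ∘ fun x => μ • v (μ * t) x) =
      (μ : ℂ) • (EuclideanSpace.complexify ∘ v (μ * t)) := by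
    intro t
    funext x
    simp only [Function.comp_apply, Pi.smul_apply, map_smul, Complex.coe_smul]
  refine ⟨fun t ht => ?_, fun t₀ ht₀ => ?_⟩
  · dsimp only
    rw [hfun]
    exact (hv.1 (μ * t) (hmaps ht)).smul (μ : ℂ)
  · have hten : Tendsto (fun t : ℝ => μ * t) (𝓝[Icc 0 T] t₀) (𝓝[Icc 0 (μ * T)] (μ * t₀)) :=
      (continuous_const_mul μ).continuousWithinAt.tendsto_nhdsWithin hmaps
    have h := (hv.2 (μ * t₀) (hmaps ht₀)).comp hten
    have h' : Tendsto (fun t => ‖(μ : ℂ)‖ₑ * Torus.eSobolevNorm β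
        (EuclideanSpace.complexify ∘ v (μ * t) - EuclideanSpace.complexify ∘ v (μ * t₀)))
        (𝓝[Icc 0 T] t₀) (𝓝 0) := by
      have := ENNReal.Tendsto.const_mul h (Or.inr (enorm_ne_top (x := (μ : ℂ))))
      rw [mul_zero] at this
      exact this
    refine h'.congr' (Eventually.of_forall fun t => ?_)
    dsimp only
    rw [hfun t, hfun t₀, ← smul_sub, Torus.eSobolevNorm_const_smul]

/-- Kinetic energy under the rescaling: `∫ |μ v(μt)|² = μ² ∫ |v(μt)|²`. [folklore] -/
theorem integral_norm_sq_smul (μ : ℝ) (w : 𝕋³ → ℝ³) :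
    ∫ x, ‖μ • w x‖ ^ 2 = μ ^ 2 * ∫ x, ‖w x‖ ^ 2 := by
  simp_rw [norm_smul, mul_pow, Real.norm_eq_abs, sq_abs]
  exact integral_const_mul _ _

/-- Zero mean is preserved by constant multiples. [folklore] -/
theorem hasZeroMean_smul (μ : ℝ) {w : 𝕋³ → ℝ³} (hw : Torus.HasZeroMean w) :
    Torus.HasZeroMean (fun x => μ • w x) := by
  unfold Torus.HasZeroMean at hw ⊢
  rw [integral_smul, hw, smul_zero]

end Rescale

/-! ## Thm. 1.2 as printed (named fact) and the scaling step to the catalogued barrier -/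

/-- **Buckmaster–Vicol 2019, Thm. 1.2 (Nonuniqueness of weak solutions) — named fact, as
printed.** §1, p. 2: the equations are posed on `T³ × ℝ` "with periodic boundary conditions …
We consider solutions normalized to have zero spatial mean … The constant `ν ∈ (0,1]` is the
kinematic viscosity"; Def. 1.1: "`v ∈ C⁰(ℝ; L²(T³))` is a weak solution of (1.1) if for any
`t ∈ ℝ` the vector field `v(·,t)` is weakly divergence free, has zero mean, and (1.1) is satisfied
in `𝒟'(T³ × ℝ)`", i.e. `∫∫ v·(∂ₜφ + (v·∇)φ + νΔφ) = 0` for smooth compactly supported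
divergence-free `φ`; Thm. 1.2: "There exists `β > 0`, such that for any nonnegative smooth
function `e(t) : [0,T] → ℝ_{≥0}`, there exists `v ∈ C⁰_t([0,T]; H^β_x(T³))` a weak solution of
the Navier–Stokes equations, such that `∫_{T³} |v(x,t)|² dx = e(t)` for all `t ∈ [0,T]`.
Moreover, the associated vorticity `∇ × v` lies in `C⁰_t([0,T]; L¹_x(T³))`."

*Transcription.* For every viscosity `ν ∈ (0,1]` (fixed before the theorem in the source, so
`β` may depend on it) there is `β > 0` such that for every `T > 0` and every `e` smooth and
nonnegative on `[0,T]` (`ContDiffOn ℝ ∞ e (Icc 0 T)`) there is a field `v` which is a weak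
solution on `T³ × (0,T)` in the accepted sense `Torus.IsWeakNSSolutionOn T ν v` (distributional,
`L²_{t,x}`, weakly divergence free for a.e. `t`; tests compactly supported in `(0,T)` — the
local-in-time content of Def. 1.1) with zero mean at every `t ∈ [0,T]`, `v ∈ C⁰([0,T]; H^β)`
(`Torus.ContinuousInSobolevOn`, spectral norm of the complexified field) and
`∫ |v(t)|² = e(t)` on `[0,T]`. Unit torus `T³ = (ℝ/ℤ)³` with probability Haar measure (the tree's
`FlatTorus` decision; the printed `T³ = ℝ³/2πℤ³` is carried to it by the parabolic scaling
`v ↦ λ v(λx, λ²t)`, `λ = 2π`, which preserves `ν` and maps smooth energy profiles onto smooth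
energy profiles). The vorticity clause is not transcribed (weaker statement). Proof in the
source: §2.4 from the iterative Prop. 2.1 (§§3–6); not formalised here — see
`BuckmasterVicolNonuniqueness_of_thm12` for what this fact yields.
[cite: BuckmasterVicol2019AnnMath, Def. 1.1 and Thm. 1.2; §1 p. 2 (`ν ∈ (0,1]`, zero mean)] -/
def BuckmasterVicol2019_thm12 : Prop :=
  ∀ ν : ℝ, 0 < ν → ν ≤ 1 →
    ∃ β : ℝ, 0 < β ∧ ∀ T : ℝ, 0 < T → ∀ e : ℝ → ℝ,
      ContDiffOn ℝ ∞ e (Icc 0 T) → (∀ t ∈ Icc 0 T, 0 ≤ e t) →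
      ∃ v : ℝ → 𝕋³ → ℝ³,
        Torus.IsWeakNSSolutionOn T ν v ∧ (∀ t ∈ Icc 0 T, Torus.HasZeroMean (v t)) ∧
        Torus.ContinuousInSobolevOn (Icc 0 T) β (fun t => EuclideanSpace.complexify ∘ v t) ∧
        ∀ t ∈ Icc 0 T, ∫ x, ‖v t x‖ ^ 2 = e t

open Literature.Barriers.AnomalousDissipation in
/-- **The scaling step (proved): Thm. 1.2 at `ν = 1` implies the in-tree `ν`-general statement**
`Literature.Analysis.FluidPDE.buckmasterVicol_nonuniqueness` (one `β` for all `ν > 0`). Given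
`ν > 0`, `T > 0` and a profile `e` on `[0,T]`, run Thm. 1.2 with viscosity `1` on `[0, νT]` with
the profile `e₁(s) = ν⁻² e(s/ν)` and rescale time: `u(t,x) = ν v(νt, x)` is a weak solution
with viscosity `ν` on `(0,T)` (`isWeakNSSolutionOn_time_rescale`), of zero mean, in
`C⁰([0,T]; H^β)` with the same `β` (`continuousInSobolevOn_time_rescale`), and
`∫|u(t)|² = ν² e₁(νt) = e(t)`; finally `u` is extended by zero off `[0,T]` (the in-tree statement
asks zero mean at every real time). This discharges scope caveat (b) of the barrier docstring
(the passage from BV's `ν ∈ (0,1]` to all `ν > 0` with a uniform `β`).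
[cite: BuckmasterVicol2019AnnMath, Thm. 1.2] -/
theorem buckmasterVicol_nonuniqueness_of_thm12 (h : BuckmasterVicol2019_thm12) :
    Literature.Analysis.FluidPDE.buckmasterVicol_nonuniqueness := by
  obtain ⟨β, hβ, hall⟩ := h 1 one_pos le_rfl
  refine ⟨β, hβ, fun ν hν T hT e he he0 => ?_⟩
  -- the profile of the viscosity-one solution on `[0, νT]`
  set e₁ : ℝ → ℝ := fun s => (ν ^ 2)⁻¹ * e (ν⁻¹ * s) with he₁
  have hmaps : MapsTo (fun s : ℝ => ν⁻¹ * s) (Icc 0 (ν * T)) (Icc 0 T) := by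
    intro s hs
    refine ⟨mul_nonneg (inv_nonneg.2 hν.le) hs.1, ?_⟩
    rw [inv_mul_le_iff₀ hν]
    exact hs.2
  have he₁s : ContDiffOn ℝ ∞ e₁ (Icc 0 (ν * T)) :=
    contDiffOn_const.mul (he.comp (contDiff_const.mul contDiff_id).contDiffOn hmaps)
  have he₁0 : ∀ s ∈ Icc 0 (ν * T), 0 ≤ e₁ s := fun s hs =>
    mul_nonneg (inv_nonneg.2 (sq_nonneg ν)) (he0 _ (hmaps hs))
  obtain ⟨v, hweak, hmean, hcont, henergy⟩ := hall (ν * T) (mul_pos hν hT) e₁ he₁s he₁0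
  -- the rescaled field, extended by zero off `[0,T]`
  set u : ℝ → 𝕋³ → ℝ³ := fun t x => ν • v (ν * t) x with hu
  set W : ℝ → 𝕋³ → ℝ³ := fun t => if t ∈ Icc 0 T then u t else 0 with hW
  have hWeq : ∀ t ∈ Icc 0 T, W t = u t := fun t ht => if_pos ht
  have hmapsT : MapsTo (fun t : ℝ => ν * t) (Icc 0 T) (Icc 0 (ν * T)) := fun t ht =>
    ⟨mul_nonneg hν.le ht.1, mul_le_mul_of_nonneg_left ht.2 hν.le⟩
  refine ⟨W, ?_, ?_, ?_, ?_⟩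
  · have hw : Torus.IsWeakNSSolutionOn T ν u := by
      have := isWeakNSSolutionOn_time_rescale (T := T) (ν₁ := 1) hν hweak
      rwa [mul_one] at this
    exact isWeakNSSolutionOn_congr (fun t ht => hWeq t (Ioo_subset_Icc_self ht)) hw
  · intro t
    by_cases ht : t ∈ Icc 0 T
    · rw [hWeq t ht]
      exact hasZeroMean_smul ν (hmean _ (hmapsT ht))
    · rw [show W t = 0 from if_neg ht]
      simp [Torus.HasZeroMean]
  · exact continuousInSobolevOn_congr
      (fun t ht => by
        show EuclideanSpace.complexify ∘ W t = EuclideanSpace.complexify ∘ u t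
        rw [hWeq t ht])
      (continuousInSobolevOn_time_rescale hν hcont)
  · intro t ht
    rw [hWeq t ht]
    show ∫ x, ‖ν • v (ν * t) x‖ ^ 2 = e t
    rw [integral_norm_sq_smul, henergy _ (hmapsT ht), he₁]
    dsimp only
    rw [inv_mul_cancel_left₀ hν.ne', ← mul_assoc, mul_inv_cancel₀ (pow_ne_zero 2 hν.ne'), one_mul]

/-- **The catalogued barrier from Thm. 1.2 as printed** (proved reduction):
`BuckmasterVicolNonuniqueness` is definitionally the in-tree `ν`-general statement, which
follows from `BuckmasterVicol2019_thm12` by `buckmasterVicol_nonuniqueness_of_thm12`.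
[cite: BuckmasterVicol2019AnnMath, Thm. 1.2] -/
theorem BuckmasterVicolNonuniqueness_of_thm12 (h : BuckmasterVicol2019_thm12) :
    BuckmasterVicolNonuniqueness :=
  buckmasterVicol_nonuniqueness_of_thm12 h

/-! ## Thm. 1.2 as printed and the in-tree `ν`-general statement are equivalent -/

/-- **Converse of the scaling step (proved): the in-tree `ν`-general statement implies Thm. 1.2
as printed.** `Literature.Analysis.FluidPDE.buckmasterVicol_nonuniqueness` provides one `β > 0`
serving every `ν > 0`, with zero mean at every real time; restricting to `ν ∈ (0,1]` and to
`t ∈ [0,T]` gives `BuckmasterVicol2019_thm12` verbatim. Together with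
`buckmasterVicol_nonuniqueness_of_thm12` this shows that the printed Thm. 1.2, the in-tree ns.S18
statement and the catalogued barrier `BuckmasterVicolNonuniqueness` are one and the same named
fact up to proved equivalence (`BuckmasterVicol2019_thm12_iff`,
`BuckmasterVicol2019_thm12_iff_barrier`), reduced to Prop. 2.1 (`BuckmasterVicol2019_prop21`) by
part III (`BuckmasterVicolNonuniquenessIteration`). [cite: BuckmasterVicol2019AnnMath, Thm. 1.2; §1 p. 2 (`ν ∈ (0,1]`)] -/
theorem BuckmasterVicol2019_thm12_of_nonuniqueness
    (h : Literature.Analysis.FluidPDE.buckmasterVicol_nonuniqueness) :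
    BuckmasterVicol2019_thm12 := by
  intro ν hν _
  obtain ⟨β, hβ, hall⟩ := h
  refine ⟨β, hβ, fun T hT e he he0 => ?_⟩
  obtain ⟨v, hweak, hmean, hcont, henergy⟩ := hall ν hν T hT e he he0
  exact ⟨v, hweak, fun t _ => hmean t, hcont, henergy⟩

/-- **Thm. 1.2 as printed ↔ the in-tree `ν`-general statement** (ns.S18,
`Literature.Analysis.FluidPDE.buckmasterVicol_nonuniqueness`): `→` is the proved time-rescaling
step `buckmasterVicol_nonuniqueness_of_thm12`, `←` is `BuckmasterVicol2019_thm12_of_nonuniqueness`.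
[cite: BuckmasterVicol2019AnnMath, Thm. 1.2] -/
theorem BuckmasterVicol2019_thm12_iff :
    BuckmasterVicol2019_thm12 ↔ Literature.Analysis.FluidPDE.buckmasterVicol_nonuniqueness :=
  ⟨buckmasterVicol_nonuniqueness_of_thm12, BuckmasterVicol2019_thm12_of_nonuniqueness⟩

/-- **Thm. 1.2 as printed ↔ the catalogued barrier** `BuckmasterVicolNonuniqueness` (which is the
in-tree `ν`-general statement by `rfl`). [cite: BuckmasterVicol2019AnnMath, Thm. 1.2] -/
theorem BuckmasterVicol2019_thm12_iff_barrier :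
    BuckmasterVicol2019_thm12 ↔ BuckmasterVicolNonuniqueness :=
  BuckmasterVicol2019_thm12_iff

end Literature.Barriers.NavierStokesRegularity

end
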